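import Mathlib
import HarnessLib
import Summits.NavierStokesRegularity.NavierStokesRegularity.Theorems.UnthreadedRigidityDoorUnthreadedRigidityVirialHornTwoChannelCascade
import Summits.NavierStokesRegularity.NavierStokesRegularity.Theorems.UnthreadedRigidityDoorUnthreadedRigidityHornPressureBracket
import Summits.NavierStokesRegularity.NavierStokesRegularity.Theorems.UnthreadedRigidityDoorUnthreadedRigidityVirialHornShellDecay

/-!
# Route `UnthreadedRigidityDoor`, item `UnthreadedRigidity` (W2, stmt-NavierStokesRegularity-27585) — LINE g11-1 «VIRIAL HORN»,
# BRIDGE V for PLATEAU PROFILES («TWO-CHANNEL RIGIDITY»), file 2: THE PRESSURE SOURCE σ = div((u₀·∇)u₀) OF THE DEGREE-`l` SHELL IN THE CASCADE BASIS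

Prover file (W2 Lean hand ns-crc-p1 g10, by lineage; `--supports stmt-NavierStokesRegularity-27585 --as helper`; objects BY NAME in
`Theorems/UnthreadedRigidityDoorUnthreadedRigidityVirialHornTwoChannelDefs.lean`, p726708).

Content: the Hessian matrix `hessMat P y` is the derivative of the gradient of `evalE P` (symmetric, trace free for harmonic `P`, Euler rows
`Σⱼ(∂ᵢ∂ⱼY)yⱼ = (l−1)∂ᵢY`); ★ `trace_shellDeriv_comp_of_euler` — crc-p1 g9's generic trace formula `HornPressure.trace_shellDeriv_comp_generic`
specialised by the Euler identities of a degree-`l` solid harmonic (pure algebra: `tr(T∘T) = A²Σ(∂ᵢ∂ⱼY)² + chanG·|∇Y|² + chanY·Y²`);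
the derivative of the explicit shell `ampA(|w|²)∇Y − 2l h′(|w|²)Y w` about any centre; ★★ `divergence_convect_sepShellL` and
`divergence_convect_sepShellL_cascade`: `σ(x₀+y) = Σ_{k≤l} cascadeSrc_k(|y|²)·F_k(y)` (`F_k = Δᵏ(Y²)`; only `k ≤ 2` contribute).
HONEST LABEL: slice-level calculus / real analysis about SPECIAL (separable) data; a piece of the L-part of ONE bridge of a RUNG line on the
wall item; `UnthreadedRigidity` (27585), W2 and NS regularity remain OPEN; nothing here is a statement about Navier–Stokes regularity.  0 kit.
-/

-- the summit and its single sub-problem share the name (CONVENTIONS §1), as in every Theorems file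
set_option linter.dupNamespace false

namespace Summit.NavierStokesRegularity.NavierStokesRegularity.Theorems.UnthreadedRigidity.VirialHorn

open scoped RealInnerProductSpace Topology Laplacian
open Filter Set MvPolynomial
open Literature.Combinatorics.LorentzianPolynomials (pderiv_pderiv_comm)
open Summit.NavierStokesRegularity.NavierStokesRegularity.Theorems.UnthreadedRigidity.ProfileHorn (E3)
open Summit.NavierStokesRegularity.NavierStokesRegularity.Theorems.PoloidalLiouville.HorizonTower hiding E3

/-! ## §3 The pressure source of the degree-`l` separable shell -/

section Source

open Literature.Analysis.FluidPDE
open Summit.NavierStokesRegularity.NavierStokesRegularity.Theorems.UnthreadedRigidity.HornPressure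
  (matCLM shellDeriv matCLM_apply trace_shellDeriv_comp_generic)

variable {P : MvPolynomial (Fin 3) ℝ} {l : ℕ}

/-- a coordinate sum is the real inner product. -/
theorem sum_mul_eq_inner (a b : E3) : ∑ k : Fin 3, a k * b k = ⟪a, b⟫ := by
  simp [PiLp.inner_apply, mul_comm]

/-- `Σ aₖ² = |a|²`. -/
theorem sum_mul_self_eq_norm_sq (a : E3) : ∑ k : Fin 3, a k * a k = ‖a‖ ^ 2 := by
  rw [sum_mul_eq_inner, real_inner_self_eq_norm_sq]

/-- the Hessian matrix of a polynomial is symmetric. -/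
theorem hessMat_symm (P : MvPolynomial (Fin 3) ℝ) (y : E3) (i j : Fin 3) : hessMat P y i j = hessMat P y j i := by
  simp [hessMat, pderiv_pderiv_comm i j]

/-- ★ THE HESSIAN IS THE DERIVATIVE OF THE GRADIENT: `D(∇(evalE P))(y) = matCLM (hessMat P y)`. -/
theorem hasFDerivAt_gradient_evalE (P : MvPolynomial (Fin 3) ℝ) (y : E3) :
    HasFDerivAt (gradient (Zonal.evalE P)) (matCLM (hessMat P y)) y := by
  rw [← hasFDerivWithinAt_univ, hasFDerivWithinAt_euclidean]
  intro i
  have hfun : (fun x => gradient (Zonal.evalE P) x i) = Zonal.evalE (pderiv i P) :=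
    funext fun x => Zonal.gradient_evalE_apply P x i
  rw [hfun, hasFDerivWithinAt_univ]
  refine (Zonal.hasFDerivAt_evalE (pderiv i P) y).congr_fderiv ?_
  ext v
  rw [ContinuousLinearMap.comp_apply, Zonal.gradCLM_apply]
  simp [matCLM_apply, hessMat]

/-- `fderiv` form of the previous lemma. -/
theorem fderiv_gradient_evalE (P : MvPolynomial (Fin 3) ℝ) (y : E3) :
    fderiv ℝ (gradient (Zonal.evalE P)) y = matCLM (hessMat P y) :=
  (hasFDerivAt_gradient_evalE P y).fderiv

/-- EULER FOR THE HESSIAN ROWS of a solid harmonic: `Σⱼ (∂ᵢ∂ⱼY) yⱼ = (l−1) ∂ᵢY`. -/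
theorem hessMat_mulVec_self (hP : P.IsHomogeneous l) (hlap : Zonal.lapP P = 0) (y : E3) (i : Fin 3) :
    ∑ j : Fin 3, hessMat P y i j * y j = ((l : ℝ) - 1) * gradient (Zonal.evalE P) y i := by
  have hY : IsSolidHarmonic l (Zonal.evalE P) := isSolidHarmonic_evalE hP hlap
  have h := hY.hessian_apply_self y
  rw [fderiv_gradient_evalE] at h
  have := congrArg (fun v : E3 => v i) h
  simpa [matCLM_apply] using this

/-- the Hessian of a harmonic polynomial is trace free. -/
theorem hessMat_trace (hlap : Zonal.lapP P = 0) (y : E3) : ∑ i : Fin 3, hessMat P y i i = 0 := by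
  have h : Zonal.evalE (Zonal.lapP P) y = 0 := by rw [hlap]; simp
  simpa [Zonal.lapP, hessMat, Fin.sum_univ_three] using h

/-- `Σᵢⱼ MᵢⱼMⱼᵢ = Σᵢⱼ (∂ᵢ∂ⱼP)²` for the Hessian matrix. -/
theorem hessMat_sq_sum (P : MvPolynomial (Fin 3) ℝ) (y : E3) :
    ∑ i : Fin 3, ∑ j : Fin 3, hessMat P y i j * hessMat P y j i =
      ∑ i : Fin 3, ∑ j : Fin 3, Zonal.evalE (pderiv i (pderiv j P)) y ^ 2 := by
  refine Finset.sum_congr rfl fun i _ => Finset.sum_congr rfl fun j _ => ?_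
  rw [hessMat_symm P y i j, ← sq]
  simp [hessMat]

/-- STAGE 2 FOR A GENERAL SOLID HARMONIC (pure algebra): g9's generic trace formula specialised by the Euler identities
`M z = (λ−1) g`, `⟪z,g⟫ = λ Y`, `tr M = 0` (`M` symmetric):
`tr(T∘T) = A²·Hq + G·(4(λ−1)AA′ − 4sA′B − 2(λ−1)AB) + Y²·(4λ²A′² + 4s²B′² + (λ²+2λ+3)B² − 8λsA′B′ − 4λA′B − 4λ(λ−1)AB′ + 4(λ+1)sBB′)`. -/
theorem trace_shellDeriv_comp_of_euler (M : Matrix (Fin 3) (Fin 3) ℝ) (z g : E3) (A A' B B' Yv lam s G Hq : ℝ)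
    (h10 : M 1 0 = M 0 1) (h20 : M 2 0 = M 0 2) (h21 : M 2 1 = M 1 2)
    (hzg : ∑ k : Fin 3, z k * g k = lam * Yv) (hzz : ∑ k : Fin 3, z k * z k = s) (hgg : ∑ k : Fin 3, g k * g k = G)
    (htr : ∑ i : Fin 3, M i i = 0) (hMM : ∑ i : Fin 3, ∑ j : Fin 3, M i j * M j i = Hq)
    (hMz : ∀ i : Fin 3, ∑ j : Fin 3, M i j * z j = (lam - 1) * g i) :
    LinearMap.trace ℝ E3 ((shellDeriv M z g A A' B B' Yv).comp (shellDeriv M z g A A' B B' Yv) : E3 →ₗ[ℝ] E3) =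
      A ^ 2 * Hq + G * (4 * (lam - 1) * A * A' - 4 * s * A' * B - 2 * (lam - 1) * A * B)
        + Yv ^ 2 * (4 * lam ^ 2 * A' ^ 2 + 4 * s ^ 2 * B' ^ 2 + (lam ^ 2 + 2 * lam + 3) * B ^ 2
            - 8 * lam * s * A' * B' - 4 * lam * A' * B - 4 * lam * (lam - 1) * A * B' + 4 * (lam + 1) * s * B * B') := by
  have h0 := hMz 0
  have h1 := hMz 1
  have h2 := hMz 2
  simp only [Fin.sum_univ_three] at h0 h1 h2
  rw [h10] at h1
  rw [h20, h21] at h2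
  have hgg' := hgg
  have hzg' := hzg
  simp only [Fin.sum_univ_three] at hgg' hzg'
  have e1 : ∑ i : Fin 3, z i * ∑ j : Fin 3, M i j * g j = (lam - 1) * G := by
    simp only [Fin.sum_univ_three, h10, h20, h21]
    linear_combination g 0 * h0 + g 1 * h1 + g 2 * h2 + (lam - 1) * hgg'
  have e2 : ∑ i : Fin 3, z i * ∑ j : Fin 3, M i j * z j = (lam - 1) * (lam * Yv) := by
    simp only [Fin.sum_univ_three, h10, h20, h21]
    linear_combination z 0 * h0 + z 1 * h1 + z 2 * h2 + (lam - 1) * hzg'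
  have e3 : ∑ i : Fin 3, g i * ∑ j : Fin 3, M i j * z j = (lam - 1) * G := by
    simp only [Fin.sum_univ_three, h10, h20, h21]
    linear_combination g 0 * h0 + g 1 * h1 + g 2 * h2 + (lam - 1) * hgg'
  rw [trace_shellDeriv_comp_generic, e1, e2, e3, hzg, hzz, hgg, htr, hMM]
  ring

/-- derivative of the strain amplitude in `s`: `ampA′ = (l+3)h′ + 2sh″`. -/
theorem hasDerivAt_ampA {h : ℝ → ℝ} (hh : ContDiff ℝ (⊤ : ℕ∞) h) (l : ℕ) (σ : ℝ) :
    HasDerivAt (ampA l h) (((l : ℝ) + 3) * deriv h σ + 2 * σ * deriv (deriv h) σ) σ := by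
  have hd : Differentiable ℝ h := hh.differentiable (by simp)
  have hd' : Differentiable ℝ (deriv h) := (contDiff_deriv_of_contDiff_top hh).differentiable (by simp)
  have h1 : HasDerivAt (fun σ : ℝ => 2 * σ) 2 σ := by simpa using (hasDerivAt_id σ).const_mul (2 : ℝ)
  have h2 := (h1.mul (hd' σ).hasDerivAt).add ((hd σ).hasDerivAt.const_mul (((l : ℝ) + 1)))
  unfold ampA
  exact h2.congr_deriv (by ring)

/-- ★ THE DERIVATIVE OF THE CENTRED EXPLICIT SHELL `w ↦ ampA(|w|²)·∇Y(w) − (2l h′(|w|²) Y(w))·w` at `z` is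
`shellDeriv (hessMat P z) z ∇Y(z) A A′ B B′ Y(z)` with `A = ampA`, `A′ = (l+3)h′ + 2sh″`, `B = 2l h′`, `B′ = 2l h″` at `s = |z|²`. -/
theorem hasFDerivAt_explicitShellL (P : MvPolynomial (Fin 3) ℝ) (l : ℕ) {h : ℝ → ℝ} (hh : ContDiff ℝ (⊤ : ℕ∞) h) (z : E3) :
    HasFDerivAt (fun w : E3 => ampA l h (‖w‖ ^ 2) • gradient (Zonal.evalE P) w
        - (2 * (l : ℝ) * deriv h (‖w‖ ^ 2) * Zonal.evalE P w) • w)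
      (shellDeriv (hessMat P z) z (gradient (Zonal.evalE P) z) (ampA l h (‖z‖ ^ 2))
        (((l : ℝ) + 3) * deriv h (‖z‖ ^ 2) + 2 * ‖z‖ ^ 2 * deriv (deriv h) (‖z‖ ^ 2))
        (2 * (l : ℝ) * deriv h (‖z‖ ^ 2)) (2 * (l : ℝ) * deriv (deriv h) (‖z‖ ^ 2)) (Zonal.evalE P z)) z := by
  have hd' : Differentiable ℝ (deriv h) := (contDiff_deriv_of_contDiff_top hh).differentiable (by simp)
  have hb1 : ∀ σ : ℝ, HasDerivAt (fun σ => 2 * (l : ℝ) * deriv h σ) (2 * (l : ℝ) * deriv (deriv h) σ) σ :=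
    fun σ => (hd' σ).hasDerivAt.const_mul _
  have hN : HasFDerivAt (fun y : E3 => ‖y‖ ^ 2) (2 • innerSL ℝ z) z := (hasStrictFDerivAt_norm_sq z).hasFDerivAt
  have hA := (hasDerivAt_ampA hh l (‖z‖ ^ 2)).comp_hasFDerivAt z hN
  have hB := (hb1 (‖z‖ ^ 2)).comp_hasFDerivAt z hN
  have hG := hasFDerivAt_gradient_evalE P z
  have hY := Zonal.hasFDerivAt_evalE P z
  have hV := (hA.smul hG).sub ((hB.mul hY).smul (hasFDerivAt_id z))
  refine (hV.congr_of_eventuallyEq (Eventually.of_forall fun w => rfl)).congr_fderiv ?_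
  ext v i
  simp [shellDeriv, matCLM_apply, PiLp.inner_apply, RCLike.inner_apply, Fin.sum_univ_three, Zonal.gradCLM_apply,
    Zonal.gradient_evalE_apply, Zonal.fderiv_evalE_apply, two_smul, hessMat]
  ring

/-- THE SHELL ABOUT `x₀` IS THE TRANSLATE OF THE CENTRED EXPLICIT SHELL (degree `l`, `Y = evalE P`). -/
theorem sepShellL_eq_explicit (hP : P.IsHomogeneous l) (hlap : Zonal.lapP P = 0) {H h : ℝ → ℝ}
    (hh : ContDiff ℝ (⊤ : ℕ∞) h) (hHh : ∀ r : ℝ, 0 ≤ r → H r = h (r ^ 2)) (x₀ : E3) :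
    sepShellL H (Zonal.evalE P) x₀ = fun x : E3 =>
      ampA l h (‖x - x₀‖ ^ 2) • gradient (Zonal.evalE P) (x - x₀)
        - (2 * (l : ℝ) * deriv h (‖x - x₀‖ ^ 2) * Zonal.evalE P (x - x₀)) • (x - x₀) := by
  rw [sepShellL_eq_comp_sub hHh]
  funext x
  rw [curl_curl_shell_apply (hh.of_le (by norm_cast)) (isSolidHarmonic_evalE hP hlap)]
  simp only [ampA]

/-- the derivative of the shell about `x₀` at `x₀ + z`. -/
theorem hasFDerivAt_sepShellL_add (hP : P.IsHomogeneous l) (hlap : Zonal.lapP P = 0) {H h : ℝ → ℝ}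
    (hh : ContDiff ℝ (⊤ : ℕ∞) h) (hHh : ∀ r : ℝ, 0 ≤ r → H r = h (r ^ 2)) (x₀ z : E3) :
    HasFDerivAt (sepShellL H (Zonal.evalE P) x₀)
      (shellDeriv (hessMat P z) z (gradient (Zonal.evalE P) z) (ampA l h (‖z‖ ^ 2))
        (((l : ℝ) + 3) * deriv h (‖z‖ ^ 2) + 2 * ‖z‖ ^ 2 * deriv (deriv h) (‖z‖ ^ 2))
        (2 * (l : ℝ) * deriv h (‖z‖ ^ 2)) (2 * (l : ℝ) * deriv (deriv h) (‖z‖ ^ 2)) (Zonal.evalE P z)) (x₀ + z) := by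
  have hT : HasFDerivAt (fun x : E3 => x - x₀) (ContinuousLinearMap.id ℝ E3) (x₀ + z) := (hasFDerivAt_id _).sub_const x₀
  have hz : x₀ + z - x₀ = z := add_sub_cancel_left x₀ z
  have hV := hasFDerivAt_explicitShellL P l hh (x₀ + z - x₀)
  have hc := hV.comp (x₀ + z) hT
  rw [hz, ContinuousLinearMap.comp_id] at hc
  rw [sepShellL_eq_explicit hP hlap hh hHh x₀]
  exact hc.congr_of_eventuallyEq (Eventually.of_forall fun x => rfl)

/-- ★★ THE SOURCE OF THE SLICE POISSON EQUATION IN EVERY DEGREE: for a solid harmonic `Y = evalE P` of degree `l`, a profile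
`H(r) = h(r²)` (`h` smooth) and the smooth divergence-free shell `u₀ = sepShellL H Y x₀`,
`div((u₀·∇)u₀)(x₀ + y) = ampA(s)²·Σᵢⱼ(∂ᵢ∂ⱼY)²(y) + chanG(s)·|∇Y(y)|² + chanY(s)·Y(y)²`, `s = |y|²`. -/
theorem divergence_convect_sepShellL (hP : P.IsHomogeneous l) (hlap : Zonal.lapP P = 0) {H h : ℝ → ℝ}
    (hh : ContDiff ℝ (⊤ : ℕ∞) h) (hHh : ∀ r : ℝ, 0 ≤ r → H r = h (r ^ 2)) (x₀ : E3)
    (hsm : ContDiff ℝ (⊤ : ℕ∞) (sepShellL H (Zonal.evalE P) x₀))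
    (hdiv : VectorCalculus.IsDivFree (sepShellL H (Zonal.evalE P) x₀)) (y : E3) :
    VectorCalculus.divergence (convect (sepShellL H (Zonal.evalE P) x₀) (sepShellL H (Zonal.evalE P) x₀)) (x₀ + y) =
      ampA l h (‖y‖ ^ 2) ^ 2 * (∑ i : Fin 3, ∑ j : Fin 3, Zonal.evalE (pderiv i (pderiv j P)) y ^ 2)
        + chanG l h (‖y‖ ^ 2) * ‖gradient (Zonal.evalE P) y‖ ^ 2 + chanY l h (‖y‖ ^ 2) * Zonal.evalE P y ^ 2 := by
  have hY : IsSolidHarmonic l (Zonal.evalE P) := isSolidHarmonic_evalE hP hlap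
  rw [divergence_convect_self_eq (hsm.of_le (by norm_cast)) hdiv (x₀ + y), traceCLM_apply,
    (hasFDerivAt_sepShellL_add hP hlap hh hHh x₀ y).fderiv]
  have hzg : ∑ k : Fin 3, y k * gradient (Zonal.evalE P) y k = (l : ℝ) * Zonal.evalE P y := by
    rw [sum_mul_eq_inner]; exact hY.inner_self_gradient y
  rw [trace_shellDeriv_comp_of_euler (hessMat P y) y (gradient (Zonal.evalE P) y) _ _ _ _ _ (l : ℝ) (‖y‖ ^ 2)
    (‖gradient (Zonal.evalE P) y‖ ^ 2) (∑ i : Fin 3, ∑ j : Fin 3, Zonal.evalE (pderiv i (pderiv j P)) y ^ 2)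
    (hessMat_symm P y 1 0) (hessMat_symm P y 2 0) (hessMat_symm P y 2 1) hzg (sum_mul_self_eq_norm_sq y)
    (sum_mul_self_eq_norm_sq _) (hessMat_trace hlap y) (hessMat_sq_sum P y) (hessMat_mulVec_self hP hlap y)]
  simp only [chanG, chanY, ampA]
  ring

/-- beyond level two there is no source. -/
theorem cascadeSrc_of_three_le (l : ℕ) (h : ℝ → ℝ) {k : ℕ} (hk : 3 ≤ k) (s : ℝ) : cascadeSrc l h k s = 0 := by
  obtain ⟨j, rfl⟩ : ∃ j, k = j + 3 := ⟨k - 3, by omega⟩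
  rfl

/-- ★★ THE SOURCE IN THE CASCADE BASIS: `σ(x₀ + y) = Σ_{k ≤ l} cascadeSrc k (|y|²) · F_k(y)` (`l ≥ 2`; only `k ≤ 2` contribute). -/
theorem divergence_convect_sepShellL_cascade (hl : 2 ≤ l) (hP : P.IsHomogeneous l) (hlap : Zonal.lapP P = 0) {H h : ℝ → ℝ}
    (hh : ContDiff ℝ (⊤ : ℕ∞) h) (hHh : ∀ r : ℝ, 0 ≤ r → H r = h (r ^ 2)) (x₀ : E3)
    (hsm : ContDiff ℝ (⊤ : ℕ∞) (sepShellL H (Zonal.evalE P) x₀))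
    (hdiv : VectorCalculus.IsDivFree (sepShellL H (Zonal.evalE P) x₀)) (y : E3) :
    VectorCalculus.divergence (convect (sepShellL H (Zonal.evalE P) x₀) (sepShellL H (Zonal.evalE P) x₀)) (x₀ + y) =
      ∑ k ∈ Finset.range (l + 1), cascadeSrc l h k (‖y‖ ^ 2) * Zonal.evalE (sqLapP P k) y := by
  rw [divergence_convect_sepShellL hP hlap hh hHh x₀ hsm hdiv y,
    ← Finset.sum_range_add_sum_Ico _ (show 3 ≤ l + 1 by omega)]
  have hrest : ∑ k ∈ Finset.Ico 3 (l + 1), cascadeSrc l h k (‖y‖ ^ 2) * Zonal.evalE (sqLapP P k) y = 0 :=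
    Finset.sum_eq_zero fun k hk => by
      rw [cascadeSrc_of_three_le l h (Finset.mem_Ico.1 hk).1, zero_mul]
  rw [hrest, add_zero, Finset.sum_range_succ, Finset.sum_range_succ, Finset.sum_range_one,
    evalE_sqLapP_zero, evalE_sqLapP_one hlap, evalE_sqLapP_two hlap]
  simp only [cascadeSrc]
  ring

end Source

end Summit.NavierStokesRegularity.NavierStokesRegularity.Theorems.UnthreadedRigidity.VirialHorn
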